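import Mathlib
import Summits.QuantumFields.YangMills.Theorems.BalabanUVNodesN19TameConditionedHellingerLetterAlongK

/-!
# HellingerRoad §14 — OVER-AGE LARGE DEVIATION OF AN ABSTRACT REFRESH PROCESS
# (kernel of memo `Cruxes/SpineGivenEndpointR13SepCoPH/OVERAGE-RATE-READING-idea3-g13.md` §3(d)–(e); the arithmetic half of letter (V‑a))

Cell `ym-nodeO-ideate`, IDEATOR seat `ym-nodeO-idea-3` (generation g14, lens «complete»), crux K3⁷ `SpineGivenEndpointR13SepCoPH`
(stmt-QuantumFields-20544; skeleton of record v5 941dddb108cbaacf untouched).  Companion to `Cruxes/…/HellingerRoadSketch.lean`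
(edition 4, 82c73ddfae37b3c3) §13: its K-summation of record `hellingerRate_of_tameTilts` consumes the ONE-RUN over-aged masses
through the binders `(wm : ℕ → ℝ) (hwm : ∀ K, 0 ≤ wm K) (hwildA hwildB : … ≤ wm K) (hws : Summable fun K => √(wm K))` — letter (V‑a)
of the card `Ideas/hellinger-free-energy-road.md` (edition 5) and, with exponent 1, letter (AC) of `Ideas/window-key-core.md` (edition 4).
Edition 4 of the card READ (V‑a) off print ([LF‑II] = Bałaban, CMP 122 (1989) 355–392, (1.79)–(1.85), pp.380–386) in the memo named
above: a DERIVED-ON-PAPER one-run large deviation «mass of classes carrying a pending large-field component over-aged at the window key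
≤ C_w·K^{−κ₁(c − 4 log L)}», summable in √ iff `κ₁(c − 4 log L) > 2`.  The memo's §4 says what a kernel version would be: «a finite
combinatorial lemma over an abstract refresh process (epoch lengths ≤ R̄+c₀, refresh price ≥ p, positions L^{4m})».  THIS FILE IS THAT LEMMA.

THE ABSTRACT REFRESH PROCESS (dictionary to the memo, §3(b)–(e)).  Fix a run `K`, a source `t`, a birth depth `m` (steps above the key).
* `U` : the finite set of possible refresh events between birth and key (memo: steps `j`, with the position of the fresh large field
  inside the `≈120MR`-neighbourhood folded into the event label); `w j ≥ 0` : the NET relative factor of refresh `j`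
  (memo (c): `e^{−p₀^net(j)}`, drawdown of the epoch it opens and the entropies already netted out); `P j` : its price, `w j ≤ e^{−P j}`;
  `ℓ j` : the length of the pending epoch it opens (memo: `R_{j+1} + c₀`).
* COVERAGE (memo (b), the pendency lemma read off [LF‑II] p.385 L24–p.386 L13): a history whose component is over-aged by `Δ` at the key
  has a refresh pattern `S ⊆ U` whose epochs cover the over-age, `Δ ≤ Σ_{j∈S} ℓ j`.  Hence the relative mass of such histories is at most
  the PATTERN MASS `patternMass U w ℓ Δ := Σ_{S ⊆ U, Δ ≤ Σ_S ℓ} Π_{j∈S} w j` (multiplicativity of the keyed class weights over refresh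
  events RELATIVE to the small-field background = the cards' standing letter (KR); this is the MODELLING step and stays a hypothesis,
  `hmodel` below, together with the positions `e^{Λ m}` (`Λ = 4 log L`) and the birth density·volume `C₀ = vol·ε̄_w`).
* RATE (memo (d)): `θ` with `θ·ℓ j ≤ P j ∕ 2` on every event (memo: `θ = c + E := ½·inf_j p₀^net(j)∕(R_j + c₀)`), and the pattern
  entropy `Σ_{j∈U} e^{−P j∕2} ≤ Z₀ + ζ·m` (memo: `≤ o(1)` uniformly in the depth because `p₀(g_j)` grows toward the UV; the linear leak
  `ζ ≥ 0` is a free generalisation — constant prices are then admissible too — and costs `ζ` of rate).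
* TAIL (memo (e)): budgets bounded by `b = R̄ + c₀` (the memo's sub-polynomial `K^{o(1)}` refinement for UV-growing budgets is NOT
  formalised: a uniform `b` is assumed), threshold depth `x_K = b + κ₁·log K` (the window's age margin), block entropy `Λ < θ − ζ`.
CONCLUSION (`wildMass_summable_of_refreshProcess`): `∃ wm ≥ 0, Summable (√wm) ∧ wild K t ≤ wm K` for all `K`, `|t| ≤ l₀` — EXACTLY the
binder shape `hellingerRate_of_tameTilts` consumes — as soon as `κ₁·(θ − Λ − ζ) > 2` (exponent 2 = the Hellinger road's (V‑a); the
window-key-core (AC) needs only `> 1`, `wildMass_rate_of_refreshProcess` gives the rate `K^{−κ₁(θ−Λ−ζ)}` for either use).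

CHAIN (every arrow below is a theorem of this file; [folklore] finite real analysis):
§14.1 `patternSum_le` — Chernoff over patterns: `Σ_{S ⊆ U, Δ ≤ Σ_S ℓ} Π_S w ≤ e^{−θΔ}·Π_{j∈U}(1 + w j·e^{θ ℓ j})` (`Finset.prod_one_add`);
§14.2 `prod_one_add_le_exp_sum` — `Π(1 + z) ≤ e^{Σ z}`;  §14.3 `patternMass_le` — with the price letters: `≤ e^{−θΔ}·e^{Z₀ + ζ m}`;
§14.4 `sum_indicator_geom_le` ∕ `sum_indicator_exp_le` — the geometric tail over birth depths beyond a REAL threshold `x`: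
`Σ_{m<M} 𝟙[x ≤ m]·e^{−r m} ≤ e^{−r x}∕(1 − e^{−r})` (finite sums only — no `tsum`, no junk values);
§14.5 `summable_sqrt_of_le_exp_log` — `w K ≤ C·e^{−a·log K}` (`K ≥ 1`), `a > 2` ⇒ `Summable (√w)` (`Real.summable_nat_rpow`);
§14.6 `wildMass_rate_of_refreshProcess` (one `(K,t)`: `wild ≤ C₀·e^{Z₀+θb}·e^{−(θ−Λ−ζ)x}∕(1−e^{−(θ−Λ−ζ)})`) and
`wildMass_summable_of_refreshProcess` (all `K`, `t`: the (V‑a) binder list of `hellingerRate_of_tameTilts`), `wildMass_summable_pair`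
(two runs share one `wm`).  §14.7 toys (A6).

HONEST FRAMING.  [folklore] finite combinatorics and real analysis on HYPOTHESIS SHAPES.  Every letter — the event sets `U`, the factors
`w`, prices `P`, epoch lengths `ℓ`, the rate `θ`, the entropy bound `Z₀ + ζ m`, the budget `b`, the block entropy `Λ`, and above all the
MODELLING inequality `hmodel` (over-aged one-run class mass ≤ `C₀·Σ_m e^{Λm}·patternMass`) — is a hypothesis produced by nobody; their
truth for Bałaban's kernels is the memo's READING of [LF‑II] (1.79)–(1.85) (derived on paper, with three OCR spots flagged there), NOT
asserted here.  What the file converts from «derived on paper» to «kernel-checked» is the ARITHMETIC of memo §3(d)–(e) only: pattern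
Chernoff bound, entropy product, geometric tail at a real threshold, rate ⇒ √-summability.  No estimate of Bałaban's programme is proved;
nothing of Bałaban's asserted or instantiated; (V‑b) = (YG), (KR), (R′), (R‑c) untouched and UNPRINTED for d = 4; NE7 ∕ NE7b ∕ NE7c not
printed as two-run statements for d = 4; K0⁷–K3⁷ OPEN, v5 stands; counts UNMOVED; no summit statement is proved by this seat.  One finite
four-torus programme at fixed ε — NOT ℝ⁴, NOT infinite volume, NOT OS, NOT a mass gap: the Yang–Mills mass gap (Clay) is NOT proved by
any of this, and R4 (`route-QuantumFields-BalabanUVNodes`) closes only the CONDITIONAL finite-𝕋⁴ rung `BalabanLadder.UV`.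
EDITIONS: ed.1 fc427c33cd1f (§14.1–§14.7) · ed.2 ac2043c35ced (+ §14.8 plug by name) · ed.3 (this, + §14.9); earlier bodies byte-intact.
§14.9 PEIERLS DOMINATION (`sum_superset_le_prod_mul_sum`, `sum_exists_superset_le`, `overagedMass_le_patternMass_mul`): the SHAPE of `hmodel` at
one birth depth follows from (KR) read as a DOWN-CLOSED positive weight system with the factorisation-with-deficit letter `A X ≤ (Π_S w)·A(X∖S)`
plus the PENDENCY LEMMA as a deterministic containment — relative over-aged mass `≤ patternMass` [folklore: Peierls ∕ polymer-gas inequality].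
§14.8 `affinityDefectLetter_of_refreshProcesses` — PLUG BY NAME into the tree's landed K-summation
`…N19TameConditionedHellingerLetterAlongK.affinityDefectLetter_of_tameTilts` (dag-n19-w4 g6 FILE 1b, the port of this road's §13): its (V‑a) socket
`(wm) (hwm) (hwildA) (hwildB) (hws)` is filled by two refresh-process certificates, every two-run letter passed through unchanged.
One `def` (`patternMass`, a finite sum); 0 `sorry`; standard axioms; imports Mathlib + that ONE tree file (for §14.8 only; `Cruxes/` material, importable by nothing).
-/

noncomputable section

namespace YMNodeOIdeate.Idea3.HellingerRoad.RefreshProcess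

open Finset

variable {α : Type*}

/-! ## §14.1 Chernoff bound over refresh patterns [folklore] -/

/-- The PATTERN MASS at over-age `Δ`: the sum, over refresh patterns `S ⊆ U` whose opened epochs cover the over-age
(`Δ ≤ Σ_{j∈S} ℓ j`), of the product of the refresh factors. A finite sum. -/
def patternMass (U : Finset α) (w ℓ : α → ℝ) (Δ : ℝ) : ℝ :=
  ∑ S ∈ U.powerset with Δ ≤ ∑ j ∈ S, ℓ j, ∏ j ∈ S, w j

theorem patternMass_nonneg (U : Finset α) {w : α → ℝ} (ℓ : α → ℝ) (hw : ∀ j ∈ U, 0 ≤ w j) (Δ : ℝ) :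
    0 ≤ patternMass U w ℓ Δ := by
  classical
  unfold patternMass
  refine sum_nonneg fun S hS => prod_nonneg fun j hj => hw j ?_
  exact mem_powerset.1 (mem_filter.1 hS).1 hj

/-- CHERNOFF OVER PATTERNS: for `θ ≥ 0`, `Σ_{S ⊆ U, Δ ≤ Σ_S ℓ} Π_{j∈S} w j ≤ e^{−θΔ} · Π_{j∈U} (1 + w j · e^{θ ℓ j})`.
[folklore: indicator `≤ e^{θ(Σ_S ℓ − Δ)}`, then `Σ_{S ⊆ U} Π_S f = Π_U (1 + f)` (`Finset.prod_one_add`).] -/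
theorem patternSum_le (U : Finset α) (w ℓ : α → ℝ) (hw : ∀ j ∈ U, 0 ≤ w j) {θ : ℝ} (hθ : 0 ≤ θ) (Δ : ℝ) :
    patternMass U w ℓ Δ ≤ Real.exp (-(θ * Δ)) * ∏ j ∈ U, (1 + w j * Real.exp (θ * ℓ j)) := by
  classical
  unfold patternMass
  have key : ∀ S ∈ Finset.filter (fun S => Δ ≤ ∑ j ∈ S, ℓ j) U.powerset,
      ∏ j ∈ S, w j ≤ Real.exp (-(θ * Δ)) * ∏ j ∈ S, (w j * Real.exp (θ * ℓ j)) := by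
    intro S hS
    rw [mem_filter, mem_powerset] at hS
    obtain ⟨hSU, hΔ⟩ := hS
    have hP : 0 ≤ ∏ j ∈ S, w j := prod_nonneg fun j hj => hw j (hSU hj)
    have hprod : 0 ≤ θ * ((∑ j ∈ S, ℓ j) - Δ) := mul_nonneg hθ (sub_nonneg.2 hΔ)
    have h1 : 1 ≤ Real.exp (-(θ * Δ)) * Real.exp (θ * ∑ j ∈ S, ℓ j) := by
      rw [← Real.exp_add]
      exact Real.one_le_exp (by nlinarith [hprod])
    have e : ∏ j ∈ S, (w j * Real.exp (θ * ℓ j)) = (∏ j ∈ S, w j) * Real.exp (θ * ∑ j ∈ S, ℓ j) := by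
      rw [prod_mul_distrib, mul_sum, Real.exp_sum]
    rw [e]
    calc ∏ j ∈ S, w j = (∏ j ∈ S, w j) * 1 := (mul_one _).symm
      _ ≤ (∏ j ∈ S, w j) * (Real.exp (-(θ * Δ)) * Real.exp (θ * ∑ j ∈ S, ℓ j)) :=
          mul_le_mul_of_nonneg_left h1 hP
      _ = Real.exp (-(θ * Δ)) * ((∏ j ∈ S, w j) * Real.exp (θ * ∑ j ∈ S, ℓ j)) := by ring
  calc ∑ S ∈ U.powerset with Δ ≤ ∑ j ∈ S, ℓ j, ∏ j ∈ S, w j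
      ≤ ∑ S ∈ U.powerset with Δ ≤ ∑ j ∈ S, ℓ j, Real.exp (-(θ * Δ)) * ∏ j ∈ S, (w j * Real.exp (θ * ℓ j)) :=
        sum_le_sum key
    _ ≤ ∑ S ∈ U.powerset, Real.exp (-(θ * Δ)) * ∏ j ∈ S, (w j * Real.exp (θ * ℓ j)) := by
        refine sum_le_sum_of_subset_of_nonneg (filter_subset _ _) fun S hS _ => ?_
        exact mul_nonneg (Real.exp_nonneg _)
          (prod_nonneg fun j hj => mul_nonneg (hw j (mem_powerset.1 hS hj)) (Real.exp_nonneg _))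
    _ = Real.exp (-(θ * Δ)) * ∏ j ∈ U, (1 + w j * Real.exp (θ * ℓ j)) := by
        rw [← mul_sum, prod_one_add]

/-! ## §14.2 The pattern entropy: `Π (1 + z) ≤ e^{Σ z}` [folklore] -/

theorem prod_one_add_le_exp_sum (U : Finset α) {z : α → ℝ} (hz : ∀ j ∈ U, 0 ≤ z j) :
    ∏ j ∈ U, (1 + z j) ≤ Real.exp (∑ j ∈ U, z j) := by
  rw [Real.exp_sum]
  exact prod_le_prod (fun j hj => by linarith [hz j hj]) fun j hj => by linarith [Real.add_one_le_exp (z j)]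

/-! ## §14.3 Pattern mass under the price letters: `≤ e^{−θΔ} · e^{Z₀ + ζ m}` -/

/-- With `0 ≤ w j ≤ e^{−P j}`, the rate letter `θ·ℓ j ≤ P j ∕ 2` and the entropy letter `Σ_U e^{−P j∕2} ≤ Z`:
`patternMass U w ℓ Δ ≤ e^{−θΔ}·e^{Z}`. -/
theorem patternMass_le (U : Finset α) {w ℓ P : α → ℝ} (hw0 : ∀ j ∈ U, 0 ≤ w j)
    (hw : ∀ j ∈ U, w j ≤ Real.exp (-P j)) {θ : ℝ} (hθ : 0 ≤ θ) (hθP : ∀ j ∈ U, θ * ℓ j ≤ P j / 2)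
    {Z : ℝ} (hZ : ∑ j ∈ U, Real.exp (-(P j / 2)) ≤ Z) (Δ : ℝ) :
    patternMass U w ℓ Δ ≤ Real.exp (-(θ * Δ)) * Real.exp Z := by
  refine (patternSum_le U w ℓ hw0 hθ Δ).trans (mul_le_mul_of_nonneg_left ?_ (Real.exp_nonneg _))
  have hz : ∀ j ∈ U, w j * Real.exp (θ * ℓ j) ≤ Real.exp (-(P j / 2)) := fun j hj => by
    calc w j * Real.exp (θ * ℓ j) ≤ Real.exp (-P j) * Real.exp (θ * ℓ j) :=
          mul_le_mul_of_nonneg_right (hw j hj) (Real.exp_nonneg _)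
      _ = Real.exp (-P j + θ * ℓ j) := (Real.exp_add _ _).symm
      _ ≤ Real.exp (-(P j / 2)) := Real.exp_le_exp.2 (by linarith [hθP j hj])
  calc ∏ j ∈ U, (1 + w j * Real.exp (θ * ℓ j)) ≤ ∏ j ∈ U, (1 + Real.exp (-(P j / 2))) :=
        prod_le_prod (fun j hj => add_nonneg zero_le_one (mul_nonneg (hw0 j hj) (Real.exp_nonneg _)))
          fun j hj => by linarith [hz j hj]
    _ ≤ Real.exp (∑ j ∈ U, Real.exp (-(P j / 2))) := prod_one_add_le_exp_sum U fun j _ => Real.exp_nonneg _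
    _ ≤ Real.exp Z := Real.exp_le_exp.2 hZ

/-! ## §14.4 The geometric tail over birth depths beyond a (real) threshold — finite sums only [folklore] -/

/-- `Σ_{m<M} 𝟙[N ≤ m]·q^m ≤ q^N ∕ (1 − q)` for `0 ≤ q < 1`. -/
theorem sum_indicator_geom_le {q : ℝ} (hq0 : 0 ≤ q) (hq1 : q < 1) (N M : ℕ) :
    ∑ m ∈ range M, (if N ≤ m then q ^ m else 0) ≤ q ^ N / (1 - q) := by
  have h1q : 0 < 1 - q := sub_pos.2 hq1
  have inv : ∀ M : ℕ, (∑ m ∈ range M, (if N ≤ m then q ^ m else 0)) * (1 - q)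
      ≤ q ^ N - (if N ≤ M then q ^ M else q ^ N) := by
    intro M
    induction M with
    | zero =>
      rw [range_zero, sum_empty, zero_mul]
      split_ifs with h
      · rw [Nat.le_zero.1 h, sub_self]
      · rw [sub_self]
    | succ M ih =>
      rw [sum_range_succ, add_mul]
      by_cases hNM : N ≤ M
      · have hNM1 : N ≤ M + 1 := Nat.le_succ_of_le hNM
        rw [if_pos hNM, if_pos hNM1]
        rw [if_pos hNM] at ih
        have e1 : q ^ M * (1 - q) = q ^ M - q ^ (M + 1) := by ring
        linarith
      · rw [if_neg hNM, zero_mul, add_zero]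
        rw [if_neg hNM] at ih
        by_cases hNM1 : N ≤ M + 1
        · have hN : N = M + 1 := le_antisymm hNM1 (Nat.succ_le_of_lt (not_le.1 hNM))
          rw [if_pos hNM1, ← hN]
          linarith
        · rw [if_neg hNM1]
          linarith
  have hM := inv M
  have hsub : 0 ≤ (if N ≤ M then q ^ M else q ^ N) := by split_ifs <;> positivity
  rw [le_div_iff₀ h1q]
  linarith

/-- REAL THRESHOLD, EXPONENTIAL FORM: for `r > 0` and any real `x`,
`Σ_{m<M} 𝟙[x ≤ m]·e^{−r m} ≤ e^{−r x} ∕ (1 − e^{−r})` (via `⌈x⌉₊`). -/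
theorem sum_indicator_exp_le {r : ℝ} (hr : 0 < r) (x : ℝ) (M : ℕ) :
    ∑ m ∈ range M, (if x ≤ (m : ℝ) then Real.exp (-(r * m)) else 0)
      ≤ Real.exp (-(r * x)) / (1 - Real.exp (-r)) := by
  set q : ℝ := Real.exp (-r) with hq
  have hq0 : 0 ≤ q := Real.exp_nonneg _
  have hq1 : q < 1 := Real.exp_lt_one_iff.2 (by linarith)
  have h1q : 0 < 1 - q := sub_pos.2 hq1
  have hterm : ∀ m : ℕ, (if x ≤ (m : ℝ) then Real.exp (-(r * m)) else 0)
      ≤ (if ⌈x⌉₊ ≤ m then q ^ m else 0) := by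
    intro m
    by_cases hxm : x ≤ (m : ℝ)
    · rw [if_pos hxm, if_pos (Nat.ceil_le.2 hxm)]
      have e : Real.exp (-(r * m)) = q ^ m := by
        rw [hq, ← Real.exp_nat_mul]; congr 1; ring
      rw [e]
    · rw [if_neg hxm]
      split_ifs <;> positivity
  have hN : q ^ ⌈x⌉₊ ≤ Real.exp (-(r * x)) := by
    have e : q ^ ⌈x⌉₊ = Real.exp (-(r * ⌈x⌉₊)) := by
      rw [hq, ← Real.exp_nat_mul]; congr 1; ring
    rw [e]
    exact Real.exp_le_exp.2 (by nlinarith [Nat.le_ceil x])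
  calc ∑ m ∈ range M, (if x ≤ (m : ℝ) then Real.exp (-(r * m)) else 0)
      ≤ ∑ m ∈ range M, (if ⌈x⌉₊ ≤ m then q ^ m else 0) := sum_le_sum fun m _ => hterm m
    _ ≤ q ^ ⌈x⌉₊ / (1 - q) := sum_indicator_geom_le hq0 hq1 _ _
    _ ≤ Real.exp (-(r * x)) / (1 - q) := by
        rw [div_eq_mul_inv, div_eq_mul_inv]
        exact mul_le_mul_of_nonneg_right hN (inv_nonneg.2 h1q.le)

/-! ## §14.5 Rate ⇒ square-root summability [folklore: `p`-series] -/

/-- If `w K ≤ C·e^{−a·log K}` for `K ≥ 1` with `a > 2`, then `Σ_K √(w K) < ∞` (`√` of a negative is `0`). -/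
theorem summable_sqrt_of_le_exp_log {C a : ℝ} (hC : 0 ≤ C) (ha : 2 < a) (w : ℕ → ℝ)
    (hw : ∀ K : ℕ, 1 ≤ K → w K ≤ C * Real.exp (-(a * Real.log K))) :
    Summable (fun K => Real.sqrt (w K)) := by
  have hs : Summable (fun K : ℕ => Real.sqrt C * ((K : ℝ) ^ (-(a / 2)))) :=
    (Real.summable_nat_rpow.2 (by linarith)).mul_left _
  have hs1 : Summable (fun K : ℕ => Real.sqrt C * (((K + 1 : ℕ) : ℝ) ^ (-(a / 2)))) :=
    (summable_nat_add_iff 1).2 hs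
  refine (summable_nat_add_iff 1).1 (Summable.of_nonneg_of_le (fun K => Real.sqrt_nonneg _) (fun K => ?_) hs1)
  show Real.sqrt (w (K + 1)) ≤ Real.sqrt C * (((K + 1 : ℕ) : ℝ) ^ (-(a / 2)))
  have hKpos : (0 : ℝ) < ((K + 1 : ℕ) : ℝ) := by positivity
  have h := hw (K + 1) (Nat.succ_le_succ (Nat.zero_le K))
  have e : Real.exp (-(a * Real.log ((K + 1 : ℕ) : ℝ))) = ((((K + 1 : ℕ) : ℝ)) ^ (-(a / 2))) ^ 2 := by
    rw [← Real.rpow_natCast, ← Real.rpow_mul hKpos.le, Real.rpow_def_of_pos hKpos]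
    congr 1
    push_cast
    ring
  calc Real.sqrt (w (K + 1)) ≤ Real.sqrt (C * ((((K + 1 : ℕ) : ℝ)) ^ (-(a / 2))) ^ 2) :=
        Real.sqrt_le_sqrt (by rw [← e]; exact h)
    _ = Real.sqrt C * (((K + 1 : ℕ) : ℝ) ^ (-(a / 2))) := by
        rw [Real.sqrt_mul hC, Real.sqrt_sq (Real.rpow_nonneg hKpos.le _)]

/-! ## §14.6 ASSEMBLY: the over-aged one-run mass from the refresh-process letters -/

/-- ONE `(K,t)`, RATE FORM.  Letters: factors `0 ≤ w ≤ e^{−P}`, rate `θ·ℓ ≤ P∕2`, entropy `Σ_U e^{−P∕2} ≤ Z₀ + ζ·m` at birth depth `m`,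
budget `b ≥ 0`, block entropy `Λ` with `Λ + ζ < θ`, and the MODELLING letter `hmodel`: the over-aged mass `wild` is at most `C₀` times
(any upper bound of the partial sums of) the series `Σ_m 𝟙[x ≤ m]·e^{Λ m}·patternMass_m(m − b)`.  Conclusion:
`wild ≤ C₀ · e^{Z₀ + θ b} · e^{−(θ−Λ−ζ)·x} ∕ (1 − e^{−(θ−Λ−ζ)})`. -/
theorem wildMass_rate_of_refreshProcess (U : ℕ → Finset α) (w ℓ P : ℕ → α → ℝ)
    (hw0 : ∀ m, ∀ j ∈ U m, 0 ≤ w m j) (hw : ∀ m, ∀ j ∈ U m, w m j ≤ Real.exp (-P m j))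
    {θ : ℝ} (hθ : 0 ≤ θ) (hθP : ∀ m, ∀ j ∈ U m, θ * ℓ m j ≤ P m j / 2)
    {Z₀ ζ : ℝ} (hZ : ∀ m : ℕ, ∑ j ∈ U m, Real.exp (-(P m j / 2)) ≤ Z₀ + ζ * m)
    {Λ : ℝ} (hΛθ : Λ + ζ < θ) (b : ℝ)
    {wild C₀ : ℝ} (x : ℝ)
    (hmodel : ∀ s : ℝ, (∀ M : ℕ, ∑ m ∈ range M,
        (if x ≤ (m : ℝ) then Real.exp (Λ * m) * patternMass (U m) (w m) (ℓ m) ((m : ℝ) - b) else 0) ≤ s) →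
        wild ≤ C₀ * s) :
    wild ≤ C₀ * (Real.exp (Z₀ + θ * b) * (Real.exp (-((θ - Λ - ζ) * x)) / (1 - Real.exp (-(θ - Λ - ζ))))) := by
  set r : ℝ := θ - Λ - ζ with hr
  have hr0 : 0 < r := by rw [hr]; linarith
  apply hmodel
  intro M
  have hterm : ∀ m : ℕ,
      (if x ≤ (m : ℝ) then Real.exp (Λ * m) * patternMass (U m) (w m) (ℓ m) ((m : ℝ) - b) else 0)
        ≤ Real.exp (Z₀ + θ * b) * (if x ≤ (m : ℝ) then Real.exp (-(r * m)) else 0) := by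
    intro m
    by_cases hxm : x ≤ (m : ℝ)
    · rw [if_pos hxm, if_pos hxm]
      have hpm := patternMass_le (U m) (hw0 m) (hw m) hθ (hθP m) (hZ m) ((m : ℝ) - b)
      calc Real.exp (Λ * m) * patternMass (U m) (w m) (ℓ m) ((m : ℝ) - b)
          ≤ Real.exp (Λ * m) * (Real.exp (-(θ * ((m : ℝ) - b))) * Real.exp (Z₀ + ζ * m)) :=
            mul_le_mul_of_nonneg_left hpm (Real.exp_nonneg _)
        _ = Real.exp (Z₀ + θ * b) * Real.exp (-(r * m)) := by
            rw [← Real.exp_add, ← Real.exp_add, ← Real.exp_add]; congr 1; rw [hr]; ring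
        _ ≤ Real.exp (Z₀ + θ * b) * Real.exp (-(r * m)) := le_rfl
    · rw [if_neg hxm, if_neg hxm, mul_zero]
  calc ∑ m ∈ range M,
        (if x ≤ (m : ℝ) then Real.exp (Λ * m) * patternMass (U m) (w m) (ℓ m) ((m : ℝ) - b) else 0)
      ≤ ∑ m ∈ range M, Real.exp (Z₀ + θ * b) * (if x ≤ (m : ℝ) then Real.exp (-(r * m)) else 0) :=
        sum_le_sum fun m _ => hterm m
    _ = Real.exp (Z₀ + θ * b) * ∑ m ∈ range M, (if x ≤ (m : ℝ) then Real.exp (-(r * m)) else 0) := by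
        rw [mul_sum]
    _ ≤ Real.exp (Z₀ + θ * b) * (Real.exp (-(r * x)) / (1 - Real.exp (-r))) :=
        mul_le_mul_of_nonneg_left (sum_indicator_exp_le hr0 x M) (Real.exp_nonneg _)

/-- ALL `K`, `t` — THE (V‑a) BINDER LIST OF `hellingerRate_of_tameTilts` FROM THE REFRESH-PROCESS LETTERS.  Per `(K, t, m)`: event sets
`U`, factors `w ≤ e^{−P}`, epoch lengths `ℓ`, with the UNIFORM rate `θ` (`θ·ℓ ≤ P∕2`), entropy `Z₀ + ζ m`, budget `b`, block entropy `Λ`,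
threshold `x_K = b + κ₁·log K`, constant `C₀`; `wild K t ≤ 1` (a sub-probability mass); the MODELLING letter at every `K ≥ 1`.
If `κ₁·(θ − Λ − ζ) > 2` then `∃ wm ≥ 0`, `Summable (√wm)`, `wild K t ≤ wm K` for all `K` and `|t| ≤ l₀`. -/
theorem wildMass_summable_of_refreshProcess {l₀ : ℝ} (wild : ℕ → ℝ → ℝ)
    (hwild1 : ∀ K t, |t| ≤ l₀ → wild K t ≤ 1)
    {θ Λ ζ κ₁ Z₀ C₀ : ℝ} (b : ℝ) (hθ : 0 ≤ θ) (hΛθ : Λ + ζ < θ) (hκ : 2 < κ₁ * (θ - Λ - ζ))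
    (hC₀ : 0 ≤ C₀)
    (U : ℕ → ℝ → ℕ → Finset α) (w ℓ P : ℕ → ℝ → ℕ → α → ℝ)
    (hw0 : ∀ K t m, ∀ j ∈ U K t m, 0 ≤ w K t m j)
    (hw : ∀ K t m, ∀ j ∈ U K t m, w K t m j ≤ Real.exp (-P K t m j))
    (hθP : ∀ K t m, ∀ j ∈ U K t m, θ * ℓ K t m j ≤ P K t m j / 2)
    (hZ : ∀ K t (m : ℕ), ∑ j ∈ U K t m, Real.exp (-(P K t m j / 2)) ≤ Z₀ + ζ * m)
    (hmodel : ∀ (K : ℕ) (t : ℝ), |t| ≤ l₀ → 1 ≤ K → ∀ s : ℝ,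
      (∀ M : ℕ, ∑ m ∈ range M, (if b + κ₁ * Real.log (K : ℝ) ≤ (m : ℝ) then
          Real.exp (Λ * m) * patternMass (U K t m) (w K t m) (ℓ K t m) ((m : ℝ) - b) else 0) ≤ s) →
      wild K t ≤ C₀ * s) :
    ∃ wm : ℕ → ℝ, (∀ K, 0 ≤ wm K) ∧ Summable (fun K => Real.sqrt (wm K)) ∧
      ∀ K t, |t| ≤ l₀ → wild K t ≤ wm K := by
  set r : ℝ := θ - Λ - ζ with hr
  have hr0 : 0 < r := by rw [hr]; linarith
  have h1r : 0 < 1 - Real.exp (-r) := sub_pos.2 (Real.exp_lt_one_iff.2 (by linarith))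
  -- the constant and the exponent of the rate
  set C : ℝ := C₀ * (Real.exp (Z₀ + θ * b) * (Real.exp (-(r * b)) / (1 - Real.exp (-r)))) with hC
  have hC0 : 0 ≤ C := by
    rw [hC]
    exact mul_nonneg hC₀ (mul_nonneg (Real.exp_nonneg _) (div_nonneg (Real.exp_nonneg _) h1r.le))
  set a : ℝ := κ₁ * r with ha
  have ha2 : 2 < a := by rw [ha, hr]; exact hκ
  refine ⟨fun K => C * Real.exp (-(a * Real.log K)) + (if K = 0 then 1 else 0), fun K => ?_, ?_, fun K t ht => ?_⟩
  · have : 0 ≤ (if K = 0 then (1:ℝ) else 0) := by split_ifs <;> norm_num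
    exact add_nonneg (mul_nonneg hC0 (Real.exp_nonneg _)) this
  · refine summable_sqrt_of_le_exp_log (C := C) (a := a) hC0 ha2 _ (fun K hK => ?_)
    have hK0 : K ≠ 0 := by omega
    rw [if_neg hK0, add_zero]
  · dsimp only
    by_cases hK : K = 0
    · -- K = 0: the trivial bound `wild ≤ 1`
      subst hK
      rw [if_pos rfl]
      have := hwild1 0 t ht
      have : 0 ≤ C * Real.exp (-(a * Real.log ((0:ℕ):ℝ))) := mul_nonneg hC0 (Real.exp_nonneg _)
      linarith
    · rw [if_neg hK, add_zero]
      have hK1 : 1 ≤ K := Nat.one_le_iff_ne_zero.2 hK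
      have hrate := wildMass_rate_of_refreshProcess (U K t) (w K t) (ℓ K t) (P K t) (hw0 K t) (hw K t) hθ (hθP K t)
        (hZ K t) hΛθ b (b + κ₁ * Real.log (K : ℝ)) (hmodel K t ht hK1)
      -- rewrite the rate: e^{−r(b + κ₁ log K)} = e^{−r b}·e^{−(a log K)}
      have e : Real.exp (-((θ - Λ - ζ) * (b + κ₁ * Real.log (K : ℝ))))
          = Real.exp (-(r * b)) * Real.exp (-(a * Real.log (K : ℝ))) := by
        rw [← Real.exp_add]; congr 1; rw [ha, hr]; ring
      rw [e] at hrate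
      calc wild K t ≤ C₀ * (Real.exp (Z₀ + θ * b) * (Real.exp (-(r * b)) * Real.exp (-(a * Real.log K))
            / (1 - Real.exp (-(θ - Λ - ζ))))) := hrate
        _ = C * Real.exp (-(a * Real.log K)) := by rw [hC, hr]; ring

/-- TWO RUNS (the consumer's `hwildA`, `hwildB` share ONE `wm`): two rate certificates merge into one by `wm := wmA + wmB`
(`√(a + b) ≤ √a + √b`).  Plug: `hellingerRate_of_tameTilts … wm hwm hwildA hwildB hws …`. -/
theorem wildMass_summable_pair {l₀ : ℝ} {wildA wildB : ℕ → ℝ → ℝ}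
    (hA : ∃ wm : ℕ → ℝ, (∀ K, 0 ≤ wm K) ∧ Summable (fun K => Real.sqrt (wm K)) ∧ ∀ K t, |t| ≤ l₀ → wildA K t ≤ wm K)
    (hB : ∃ wm : ℕ → ℝ, (∀ K, 0 ≤ wm K) ∧ Summable (fun K => Real.sqrt (wm K)) ∧ ∀ K t, |t| ≤ l₀ → wildB K t ≤ wm K) :
    ∃ wm : ℕ → ℝ, (∀ K, 0 ≤ wm K) ∧ Summable (fun K => Real.sqrt (wm K)) ∧
      (∀ K t, |t| ≤ l₀ → wildA K t ≤ wm K) ∧ (∀ K t, |t| ≤ l₀ → wildB K t ≤ wm K) := by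
  obtain ⟨wa, ha0, has, haw⟩ := hA
  obtain ⟨wb, hb0, hbs, hbw⟩ := hB
  refine ⟨fun K => wa K + wb K, fun K => add_nonneg (ha0 K) (hb0 K), ?_,
    fun K t ht => by linarith [haw K t ht, hb0 K], fun K t ht => by linarith [hbw K t ht, ha0 K]⟩
  refine Summable.of_nonneg_of_le (fun K => Real.sqrt_nonneg _) (fun K => ?_) (has.add hbs)
  show Real.sqrt (wa K + wb K) ≤ Real.sqrt (wa K) + Real.sqrt (wb K)
  rw [Real.sqrt_le_iff]
  refine ⟨add_nonneg (Real.sqrt_nonneg _) (Real.sqrt_nonneg _), ?_⟩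
  nlinarith [Real.sq_sqrt (ha0 K), Real.sq_sqrt (hb0 K), Real.sqrt_nonneg (wa K), Real.sqrt_nonneg (wb K),
    mul_nonneg (Real.sqrt_nonneg (wa K)) (Real.sqrt_nonneg (wb K))]

/-! ## §14.8 PLUG (by name, into the TREE): two refresh-process certificates feed the landed K-summation
`Summit.QuantumFields.YangMills.BalabanUVNodes.N19TameConditionedHellingerLetterAlongK.affinityDefectLetter_of_tameTilts` (dag-n19-w4 g6, FILE 1b) -/

open Summit.QuantumFields.YangMills.BalabanUVNodes.N19TameConditionedHellingerLetterAlongK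
  (affinityDefectLetter_of_tameTilts) in
/-- THE (V‑a) SOCKET OF THE TREE'S K-SUMMATION, FILLED BY TWO REFRESH-PROCESS CERTIFICATES.  Everything else (`hA hB hW`, radii `r` with
`Σ 1∕r_K < ∞` = (V‑b) on tame components, the tame tilt bound `𝔅`, the tame regime from `K₀`) is passed through UNCHANGED — those are the two-run
letters this file does not touch.  `hcertA`, `hcertB` are literally conclusions of `wildMass_summable_of_refreshProcess` with
`wild K t := Σ_{W K t} A ∕ Σ_{T K} A` (resp. `B`). -/
theorem affinityDefectLetter_of_refreshProcesses {ι : Type*} [DecidableEq ι] {l₀ : ℝ} (T : ℕ → Finset ι) (A B : ℕ → ℝ → ι → ℝ)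
    (hA : ∀ K t, |t| ≤ l₀ → ∀ τ ∈ T K, 0 < A K t τ) (hB : ∀ K t, |t| ≤ l₀ → ∀ τ ∈ T K, 0 < B K t τ)
    (W : ℕ → ℝ → Finset ι) (hW : ∀ K t, W K t ⊆ T K)
    (hcertA : ∃ wm : ℕ → ℝ, (∀ K, 0 ≤ wm K) ∧ Summable (fun K => Real.sqrt (wm K)) ∧
      ∀ K t, |t| ≤ l₀ → (∑ τ ∈ W K t, A K t τ) / (∑ σ ∈ T K, A K t σ) ≤ wm K)
    (hcertB : ∃ wm : ℕ → ℝ, (∀ K, 0 ≤ wm K) ∧ Summable (fun K => Real.sqrt (wm K)) ∧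
      ∀ K t, |t| ≤ l₀ → (∑ τ ∈ W K t, B K t τ) / (∑ σ ∈ T K, B K t σ) ≤ wm K)
    (r : ℕ → ℝ) (hr : ∀ K, 0 < r K) (hrs : Summable fun K => 1 / r K)
    {𝔅 : ℝ} (h𝔅 : 0 ≤ 𝔅)
    (htilt : ∀ K t, |t| ≤ l₀ → ∃ φA φB : ℂ → ℂ,
      DifferentiableOn ℂ φA (Metric.closedBall 0 (r K)) ∧ DifferentiableOn ℂ φB (Metric.closedBall 0 (r K)) ∧
      (∀ s ∈ Metric.closedBall (0:ℂ) (r K), Complex.exp (φA s)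
        = (∑ τ ∈ T K \ W K t, (A K t τ : ℂ) * Complex.exp (s * ((Real.log (B K t τ) - Real.log (A K t τ) : ℝ) : ℂ)))
            / ∑ τ ∈ T K \ W K t, (A K t τ : ℂ)) ∧
      (∀ s ∈ Metric.closedBall (0:ℂ) (r K), Complex.exp (φB s)
        = (∑ τ ∈ T K \ W K t, (B K t τ : ℂ) * Complex.exp (s * ((Real.log (B K t τ) - Real.log (A K t τ) : ℝ) : ℂ)))
            / ∑ τ ∈ T K \ W K t, (B K t τ : ℂ)) ∧
      (∀ s ∈ Metric.closedBall (0:ℂ) (r K), ‖φA s‖ ≤ 𝔅) ∧ (∀ s ∈ Metric.closedBall (0:ℂ) (r K), ‖φB s‖ ≤ 𝔅))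
    (K₀ : ℕ) (hreg : ∀ K, K₀ ≤ K → ∀ t, |t| ≤ l₀ →
      1 - ∑ τ ∈ T K \ W K t, Real.sqrt ((A K t τ / ∑ σ ∈ T K \ W K t, A K t σ) * (B K t τ / ∑ σ ∈ T K \ W K t, B K t σ))
        ≤ 1 / 16) :
    ∃ η : ℕ → ℝ, (∀ K, 0 ≤ η K) ∧ Summable (fun K => Real.sqrt (η K)) ∧
      ∀ K t, |t| ≤ l₀ →
        1 - ∑ τ ∈ T K, Real.sqrt ((A K t τ / ∑ σ ∈ T K, A K t σ) * (B K t τ / ∑ σ ∈ T K, B K t σ)) ≤ η K := by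
  obtain ⟨wm, hwm, hws, hwA, hwB⟩ := wildMass_summable_pair hcertA hcertB
  exact affinityDefectLetter_of_tameTilts T A B hA hB W hW wm hwm hwA hwB hws r hr hrs h𝔅 htilt K₀ hreg

/-! ## §14.9 PEIERLS DOMINATION — the shape of `hmodel` from a down‑closed positive weight system [folklore: the Peierls ∕ polymer‑gas
inequality «the weight of the configurations containing a given contour family is at most the product of its factors times the total weight»]

One run's keyed class weights at birth depth `m`, RELATIVE to the small‑field background, read ((KR), [LF‑II] (1.79)) as a weight system
`A : Finset β → ℝ≥0` on a DOWN‑CLOSED family `𝒜` of refresh‑event sets (sub‑histories of admissible histories are admissible) with the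
FACTORISATION‑WITH‑DEFICIT letter `A X ≤ (Π_{γ∈S} w γ)·A (X ∖ S)` for `S ⊆ X ∈ 𝒜` (`w` = NET factor: printed factor × background deficit ×
entropy, memo §3(c)).  Then the relative mass of the histories containing SOME pattern of a family `𝒮` is at most `Σ_{S∈𝒮} Π_S w` — with
`𝒮` = the covering patterns this is `patternMass`, i.e. `hmodel` at one depth follows from (KR) in this form + the PENDENCY LEMMA as a
deterministic containment («over‑aged ⇒ contains a covering refresh pattern», memo §3(b)).  What then stays a letter: the down‑closed
factorising representation itself ((KR)), the pendency containment, and the depth bookkeeping `C₀·e^{Λm}`. -/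

section Peierls
variable {β : Type*} [DecidableEq β]

/-- ONE PATTERN: `Σ_{X∈𝒜, S⊆X} A X ≤ (Π_S w)·Σ_{Y∈𝒜} A Y` for a down‑closed `𝒜`, `A ≥ 0` on `𝒜`, `w ≥ 0`, and the factorisation letter. -/
theorem sum_superset_le_prod_mul_sum (𝒜 : Finset (Finset β)) (hdown : ∀ X ∈ 𝒜, ∀ Y, Y ⊆ X → Y ∈ 𝒜)
    (A : Finset β → ℝ) (hA : ∀ X ∈ 𝒜, 0 ≤ A X) (w : β → ℝ) (hw : ∀ γ, 0 ≤ w γ) (S : Finset β)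
    (hfac : ∀ X ∈ 𝒜, S ⊆ X → A X ≤ (∏ γ ∈ S, w γ) * A (X \ S)) :
    ∑ X ∈ 𝒜 with S ⊆ X, A X ≤ (∏ γ ∈ S, w γ) * ∑ Y ∈ 𝒜, A Y := by
  have hwS : 0 ≤ ∏ γ ∈ S, w γ := prod_nonneg fun γ _ => hw γ
  -- `X ↦ X ∖ S` is injective on the sets containing `S`, with image inside `𝒜`
  have hinj : Set.InjOn (fun X : Finset β => X \ S) ↑(𝒜.filter fun X => S ⊆ X) := by
    intro X hX X' hX' h
    have hSX : S ⊆ X := (mem_filter.1 (Finset.mem_coe.1 hX)).2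
    have hSX' : S ⊆ X' := (mem_filter.1 (Finset.mem_coe.1 hX')).2
    have e1 : X = X \ S ∪ S := (sdiff_union_of_subset hSX).symm
    have e2 : X' = X' \ S ∪ S := (sdiff_union_of_subset hSX').symm
    rw [e1, e2, show X \ S = X' \ S from h]
  have himg : (𝒜.filter fun X => S ⊆ X).image (fun X => X \ S) ⊆ 𝒜 := by
    intro Y hY
    obtain ⟨X, hX, rfl⟩ := mem_image.1 hY
    exact hdown X (mem_filter.1 hX).1 _ sdiff_subset
  calc ∑ X ∈ 𝒜 with S ⊆ X, A X ≤ ∑ X ∈ 𝒜 with S ⊆ X, (∏ γ ∈ S, w γ) * A (X \ S) :=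
        sum_le_sum fun X hX => hfac X (mem_filter.1 hX).1 (mem_filter.1 hX).2
    _ = (∏ γ ∈ S, w γ) * ∑ X ∈ 𝒜 with S ⊆ X, A (X \ S) := by rw [mul_sum]
    _ = (∏ γ ∈ S, w γ) * ∑ Y ∈ (𝒜.filter fun X => S ⊆ X).image (fun X => X \ S), A Y := by
        rw [sum_image hinj]
    _ ≤ (∏ γ ∈ S, w γ) * ∑ Y ∈ 𝒜, A Y :=
        mul_le_mul_of_nonneg_left (sum_le_sum_of_subset_of_nonneg himg fun Y hY _ => hA Y hY) hwS

/-- A PATTERN FAMILY (union bound): `Σ_{X∈𝒜, ∃S∈𝒮, S⊆X} A X ≤ (Σ_{S∈𝒮} Π_S w)·Σ_{Y∈𝒜} A Y`. -/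
theorem sum_exists_superset_le (𝒜 : Finset (Finset β)) (hdown : ∀ X ∈ 𝒜, ∀ Y, Y ⊆ X → Y ∈ 𝒜)
    (A : Finset β → ℝ) (hA : ∀ X ∈ 𝒜, 0 ≤ A X) (w : β → ℝ) (hw : ∀ γ, 0 ≤ w γ)
    (hfac : ∀ X ∈ 𝒜, ∀ S, S ⊆ X → A X ≤ (∏ γ ∈ S, w γ) * A (X \ S)) (𝒮 : Finset (Finset β)) :
    ∑ X ∈ 𝒜 with (∃ S ∈ 𝒮, S ⊆ X), A X ≤ (∑ S ∈ 𝒮, ∏ γ ∈ S, w γ) * ∑ Y ∈ 𝒜, A Y := by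
  -- indicator of `∃` ≤ sum of indicators, then swap the sums and apply the one-pattern bound
  have step1 : ∑ X ∈ 𝒜 with (∃ S ∈ 𝒮, S ⊆ X), A X
      ≤ ∑ X ∈ 𝒜, ∑ S ∈ 𝒮, (if S ⊆ X then A X else 0) := by
    rw [sum_filter]
    refine sum_le_sum fun X hX => ?_
    by_cases hP : ∃ S ∈ 𝒮, S ⊆ X
    · rw [if_pos hP]
      obtain ⟨S₀, hS₀, hS₀X⟩ := hP
      have h := single_le_sum (f := fun S => if S ⊆ X then A X else 0)
        (fun S _ => by split_ifs <;> first | exact hA X hX | exact le_rfl) hS₀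
      simpa [if_pos hS₀X] using h
    · rw [if_neg hP]
      exact sum_nonneg fun S _ => by split_ifs; exacts [hA X hX, le_rfl]
  have step2 : ∑ X ∈ 𝒜, ∑ S ∈ 𝒮, (if S ⊆ X then A X else 0)
      = ∑ S ∈ 𝒮, ∑ X ∈ 𝒜 with S ⊆ X, A X := by
    rw [sum_comm]
    refine sum_congr rfl fun S _ => ?_
    rw [sum_filter]
  rw [step2] at step1
  refine step1.trans ?_
  rw [sum_mul]
  exact sum_le_sum fun S _ => sum_superset_le_prod_mul_sum 𝒜 hdown A hA w hw S (fun X hX hSX => hfac X hX S hSX)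

/-- `hmodel` AT ONE BIRTH DEPTH, FROM (KR) + PENDENCY: if every over‑aged history (`Over X`) contains a refresh pattern `S ⊆ U` whose epochs
cover the over‑age (`Δ ≤ Σ_S ℓ`), then the over‑aged weight is at most `patternMass U w ℓ Δ` times the total weight (RELATIVE mass
`≤ patternMass`). -/
theorem overagedMass_le_patternMass_mul (𝒜 : Finset (Finset β)) (hdown : ∀ X ∈ 𝒜, ∀ Y, Y ⊆ X → Y ∈ 𝒜)
    (A : Finset β → ℝ) (hA : ∀ X ∈ 𝒜, 0 ≤ A X) (w : β → ℝ) (hw : ∀ γ, 0 ≤ w γ)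
    (hfac : ∀ X ∈ 𝒜, ∀ S, S ⊆ X → A X ≤ (∏ γ ∈ S, w γ) * A (X \ S))
    (U : Finset β) (ℓ : β → ℝ) (Δ : ℝ) (Over : Finset β → Prop) [DecidablePred Over]
    (hpend : ∀ X ∈ 𝒜, Over X → ∃ S, S ⊆ U ∧ Δ ≤ ∑ j ∈ S, ℓ j ∧ S ⊆ X) :
    ∑ X ∈ 𝒜 with Over X, A X ≤ patternMass U w ℓ Δ * ∑ Y ∈ 𝒜, A Y := by
  classical
  set 𝒮 : Finset (Finset β) := U.powerset.filter fun S => Δ ≤ ∑ j ∈ S, ℓ j with h𝒮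
  have hPM : patternMass U w ℓ Δ = ∑ S ∈ 𝒮, ∏ γ ∈ S, w γ := by rw [h𝒮]; rfl
  have hsub : (𝒜.filter fun X => Over X) ⊆ 𝒜.filter fun X => ∃ S ∈ 𝒮, S ⊆ X := by
    intro X hX
    rw [mem_filter] at hX ⊢
    obtain ⟨S, hSU, hΔ, hSX⟩ := hpend X hX.1 hX.2
    exact ⟨hX.1, S, by rw [h𝒮, mem_filter, mem_powerset]; exact ⟨hSU, hΔ⟩, hSX⟩
  calc ∑ X ∈ 𝒜 with Over X, A X ≤ ∑ X ∈ 𝒜 with (∃ S ∈ 𝒮, S ⊆ X), A X :=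
        sum_le_sum_of_subset_of_nonneg hsub fun X hX _ => hA X (mem_filter.1 hX).1
    _ ≤ (∑ S ∈ 𝒮, ∏ γ ∈ S, w γ) * ∑ Y ∈ 𝒜, A Y := sum_exists_superset_le 𝒜 hdown A hA w hw hfac 𝒮
    _ = patternMass U w ℓ Δ * ∑ Y ∈ 𝒜, A Y := by rw [hPM]

/-- Toy (A6): the PURE PRODUCT weight `A X = Π_X z` (`z ≥ 0`) on ANY down‑closed family satisfies the factorisation letter with `w = z`
(equality) — the hard‑core polymer gas ∕ Peierls case. -/
example (𝒜 : Finset (Finset β)) (z : β → ℝ) (X : Finset β) (_hX : X ∈ 𝒜) (S : Finset β) (hSX : S ⊆ X) :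
    (∏ γ ∈ X, z γ) ≤ (∏ γ ∈ S, z γ) * ∏ γ ∈ X \ S, z γ := by
  rw [← prod_sdiff hSX, mul_comm]

end Peierls

/-! ## §14.7 Toys (A6): the letters are jointly inhabited, and the empty process has no over-age mass -/

/-- No refresh event ⇒ no over-age beyond the budget: the pattern mass at positive over-age vanishes. -/
example (w ℓ : α → ℝ) {Δ : ℝ} (hΔ : 0 < Δ) : patternMass (∅ : Finset α) w ℓ Δ = 0 := by
  classical
  unfold patternMass
  rw [powerset_empty]
  refine sum_eq_zero fun S hS => ?_
  rw [mem_filter, mem_singleton] at hS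
  obtain ⟨rfl, h⟩ := hS
  rw [sum_empty] at h
  exact absurd h (not_le.2 hΔ)

/-- … and at over-age `≤ 0` it is the empty product `1` (the budget itself costs nothing: memo §3(a), reserve drawdown is prepaid). -/
example (w ℓ : α → ℝ) : patternMass (∅ : Finset α) w ℓ 0 = 1 := by
  classical
  unfold patternMass
  rw [powerset_empty]
  have : ({∅} : Finset (Finset α)).filter (fun S => (0:ℝ) ≤ ∑ j ∈ S, ℓ j) = {∅} := by
    ext S; simp only [mem_filter, mem_singleton, and_iff_left_iff_imp]; rintro rfl; simp
  rw [this, sum_singleton, prod_empty]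

/-- The rate and entropy letters are jointly inhabited with room in a caricature of print's regime: constant price `P = 20` per refresh,
unit epochs, `θ = 10` (so `θ·ℓ ≤ P∕2`), per-event entropy `e^{−10}` (so `ζ = e^{−10}` serves `Σ_{j<m} e^{−P∕2} ≤ 0 + ζ m` on `U = range m`),
block entropy `Λ = 4·log 2` (`L = 2`): then `Λ + ζ < θ` and `κ₁ := 1` already gives `κ₁(θ − Λ − ζ) > 2`. -/
example : (4 * Real.log 2 + Real.exp (-10) < 10) ∧ (2 < 1 * (10 - 4 * Real.log 2 - Real.exp (-10))) := by
  have h2 : Real.log 2 < 0.6931471808 := Real.log_two_lt_d9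
  have he : Real.exp (-10) ≤ 1 := Real.exp_le_one_iff.2 (by norm_num)
  constructor <;> nlinarith

example (m : ℕ) : ∑ _j ∈ range m, Real.exp (-((20:ℝ) / 2)) ≤ 0 + Real.exp (-10) * m := by
  rw [sum_const, card_range, nsmul_eq_mul]
  norm_num [mul_comm]

end YMNodeOIdeate.Idea3.HellingerRoad.RefreshProcess
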